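import Summits.QuantumFields.YangMills.Theorems.BalabanUVNodesN19SingleModeMomentLadder

/-!
# YM-DAG node N19 (= NE7 proper) — MULTISCALE TELESCOPING, PART 8b: THE SINGLE MODE OF THE ℓ¹-NORM IN THE UNIFORM MIXED-MOMENT CURRENCY —
# `|∫cos(ωΣ_i|x_i|)dP − ∫cos(ωΣ_i|x_i|)dQ| ≤ 248(J+1)·ωd∕2^J + 9^{6(J+1)2^J}·r` for laws with `r`-close mixed moments: `≲ ωd·log²L∕L`, `L = log r⁻¹`

Cell `pub-ymgap`, HUMAN RULING D-0062 (Track A) ∕ D-0149 (work-bound push), R141 (C) wider-strategy seat `pub-ymgap-dag-n19-e` (strategy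
s3 = ALTERNATIVE CURRENCY), generation g30, module 12 (lineage module 129).  Route `Summits/QuantumFields/YangMills/Theses/BalabanUVNodes.lean`,
cluster item K3⁸ «SpineGivenEndpointR13SepCoPHV» (stmt-QuantumFields-27366); filed `--supports` that item `--as helper` (it proves no registered
stub).  COUNT-NEUTRAL: [folklore] over Mathlib and the lineage BY NAME — PART 8a `…N19SingleModeMomentLadder` (`exists_additiveJackson_mass`,
`exists_pair_near_cexp_sum_mass`), PART 1 (`norm_cexp_sub_cexp_le`), module 127 (`abs_integral_eval_sub_le_mass`, `mass_C_le`, `mass_sub_le`), module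
65∕62 (`abs_integral_le_of_cube`, `integrable_of_continuous_of_cube`); TOY laws under HYPOTHESES, no scheme object, no Theses import; NOT a discharge claim.

CONTEXT.  Module 116 priced the single mode `cos(ωΣ_i|x_i|)` in the lineage's UNIFORM MIXED-MOMENT currency at `(cosh(ωd) − 1)·96∕(1+L)` — trivial
once `ωd ≳ log L`.  PARTS 1–7 priced it in the DEGREE model at `≲ (ωd + log t)log t∕t` by multiscale telescoping.  This module runs the same ladder with
MASS bookkeeping (PART 8a) and prices the final polynomial by module 127.  With Jackson degrees `m_l = 2^{J−l}` (coarse scales get the high degree):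
sup-error `≤ 240(J+1)ωd∕2^J`, tail `ωdπ∕2^J`, mass `≤ 9^{6(J+1)2^J}` (`m_B(l) ≤ 2d·2^l9^{2^l}`, `R_l = 3dπ∕2^l`, `m_B∕R ≤ 9^{2·2^l}`).
★★★ `abs_integral_cos_l1Norm_sub_le_multiscale` (for every `J` with `240(J+1)ωd ≤ 2^J`:
`|∫cos(ωS)dP − ∫cos(ωS)dQ| ≤ 248(J+1)ωd∕2^J + 9^{6(J+1)2^J}·r`) · ★★ `abs_integral_cos_l1Norm_sub_le_multiscale_of_small` (at
`12(J+1)2^J·log 9 ≤ L = log r⁻¹`: `≤ 248(J+1)ωd∕2^J + e^{−L∕2}`; READING `2^J ≍ L∕(27(J+1))`: **`≲ 6700·ωd·log²₂L∕L`** — the single mode in the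
moment currency at the ridge rate up to `log²`, non-trivial for `ωd ≲ L∕log²L`; module 116's `(cosh(ωd)−1)·96∕(1+L)` is better only for `ωd ≲ 2log log L`).
HONEST: constants huge (Jackson mass `9^m`); the `sin` face and the AT-SCHEME face (module 67's `jointLaw_pushforward`) are routine re-runs not typed here.

HONEST FRAMING (binding).  Elementary and [folklore]; ONE-SIDED; TOY laws under hypotheses; NO consumer in the DAG today (the seat's own currency map);
nothing of Bałaban's instantiated; NE7 NOT PRINTED, NOT proved; N19 NOT discharged; count-neutral.  One finite `T⁴` programme at fixed `ε`; nothing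
continuum ∕ `ℝ⁴` ∕ OS ∕ mass-gap ∕ Clay.  0 `def` ∕ 0 `sorry`.
-/

noncomputable section

open Real Finset MeasureTheory Complex

namespace Summit.QuantumFields.YangMills.Theorems.BalabanUVNodesN19SingleModeMomentCurrency

open Summit.QuantumFields.YangMills.Theorems.BalabanUVNodesN19SingleModeMultiscale (norm_cexp_sub_cexp_le)
open Summit.QuantumFields.YangMills.Theorems.BalabanUVNodesN19CoefficientMassPricing
open Summit.QuantumFields.YangMills.Theorems.BalabanUVNodesN19SingleModeMomentLadder
open Summit.QuantumFields.YangMills.Theorems.BalabanUVNodesN19JointLawPriceDimension (abs_integral_le_of_cube)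
open Summit.QuantumFields.YangMills.Theorems.BalabanUVNodesN19JointLawBernstein (integrable_of_continuous_of_cube)

variable {ι : Type*} [Fintype ι]


/-! ## §1 ★★★ The single mode in the moment currency [folklore] -/

/-- ★★★ **THE SINGLE MODE IN THE UNIFORM MIXED-MOMENT CURRENCY.**  Let `P, Q` be probability laws on `ℝ^ι` carried by `[−1,1]^ι` with `r`-close mixed
moments (`r ≥ 0`), `ω ≥ 0`, `d = |ι| ≥ 1`, and `J` with `240(J+1)ωd ≤ 2^J`.  Then
`|∫cos(ωΣ_i|x_i|)dP − ∫cos(ωΣ_i|x_i|)dQ| ≤ 248(J+1)·ωd∕2^J + 9^{6(J+1)2^J}·r`.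
The ladder of PARTS 1∕2 with Jackson degrees `m_l = 2^{J−l}` and MASS bookkeeping: sup-error `2Σ_l 2ωR_lπ∕m_l ≤ 240(J+1)ωd∕2^J`, tail `ωdπ∕2^J`, mass
`≤ ∏_{l≤J} 2m_l9^{m_l}(m_B(l)∕R_l)^{2m_l} ≤ 9^{6(J+1)2^J}` (`m_B(l) ≤ 2d·2^l9^{2^l}`, `R_l = 3dπ∕2^l`, `log₉(m_B∕R) ≤ 2^{l+1}`), price by module 127.
[folklore] -/
theorem abs_integral_cos_l1Norm_sub_le_multiscale [Nonempty ι] {P Q : Measure (ι → ℝ)} [IsProbabilityMeasure P] [IsProbabilityMeasure Q]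
    (hP : P (Set.pi Set.univ (fun _ : ι => Set.Icc (-1 : ℝ) 1))ᶜ = 0) (hQ : Q (Set.pi Set.univ (fun _ : ι => Set.Icc (-1 : ℝ) 1))ᶜ = 0)
    {r : ℝ} (hr : 0 ≤ r) (hmom : ∀ j : ι → ℕ, |∫ x, ∏ i, x i ^ j i ∂P - ∫ x, ∏ i, x i ^ j i ∂Q| ≤ r)
    {ω : ℝ} (hω : 0 ≤ ω) {J : ℕ} (hsmall : 240 * ((J : ℝ) + 1) * ω * Fintype.card ι ≤ 2 ^ J) :
    |∫ x, Real.cos (ω * ∑ i, |x i|) ∂P - ∫ x, Real.cos (ω * ∑ i, |x i|) ∂Q| ≤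
      248 * ((J : ℝ) + 1) * ω * Fintype.card ι / 2 ^ J + 9 ^ (6 * (J + 1) * 2 ^ J) * r := by
  set d : ℝ := (Fintype.card ι : ℝ) with hd
  have hdpos : 0 < d := by rw [hd]; exact_mod_cast (Fintype.card_pos (α := ι))
  have hπ := Real.pi_pos
  have hπ4 : π ≤ 4 := Real.pi_le_four
  -- the Jackson ladder with masses
  choose A hAmass hAerr using fun l : ℕ => exists_additiveJackson_mass (ι := ι) (M := 2 ^ l) (pow_pos two_pos l)
  obtain ⟨A', hA'0, hA's⟩ : ∃ A' : ℕ → MvPolynomial ι ℝ, A' 0 = MvPolynomial.C (d / 2) ∧ ∀ l, A' (l + 1) = A l :=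
    ⟨fun l => if l = 0 then MvPolynomial.C (d / 2) else A (l - 1), if_pos rfl, fun l => by
      show (if l + 1 = 0 then MvPolynomial.C (d / 2) else A (l + 1 - 1)) = A l
      rw [if_neg (Nat.succ_ne_zero l), Nat.add_sub_cancel]⟩
  obtain ⟨B, hB⟩ : ∃ B : ℕ → MvPolynomial ι ℝ, ∀ l, B l = A l - A' l := ⟨fun l => A l - A' l, fun l => rfl⟩
  obtain ⟨R, hR0', hRs⟩ : ∃ R : ℕ → ℝ, R 0 = d * (1 / 2 + π) ∧ ∀ l, R (l + 1) = 3 * d * π / 2 ^ (l + 1) :=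
    ⟨fun l => if l = 0 then d * (1 / 2 + π) else 3 * d * π / 2 ^ l, if_pos rfl, fun l => if_neg (Nat.succ_ne_zero l)⟩
  obtain ⟨mB, hmB0, hmBs⟩ : ∃ mB : ℕ → ℝ, mB 0 = 10 * d ∧ ∀ l, mB (l + 1) = 2 * d * (2 ^ (l + 1) * 9 ^ (2 ^ (l + 1))) :=
    ⟨fun l => if l = 0 then 10 * d else 2 * d * (2 ^ l * 9 ^ (2 ^ l)), if_pos rfl, fun l => if_neg (Nat.succ_ne_zero l)⟩
  obtain ⟨m, hm⟩ : ∃ m : ℕ → ℕ, ∀ l, m l = 2 ^ (J - l) := ⟨fun l => 2 ^ (J - l), fun l => rfl⟩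
  have hRpos : ∀ l, 0 < R l := by
    intro l; cases l with
    | zero => rw [hR0']; positivity
    | succ l => rw [hRs]; positivity
  -- masses of the increments
  have hmassB : ∀ l, l < J + 1 → (∑ s ∈ (B l).support, |(B l).coeff s|) ≤ mB l := by
    intro l _
    rw [hB]
    refine (mass_sub_le _ _).trans ?_
    cases l with
    | zero =>
      rw [hA'0, hmB0]
      have h1 : (∑ s ∈ (A 0).support, |(A 0).coeff s|) ≤ d * 9 := by
        have := hAmass 0; rw [← hd] at this; simpa using this
      have h2 := mass_C_le (ι := ι) (d / 2)
      rw [abs_of_nonneg (by positivity)] at h2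
      linarith
    | succ l =>
      rw [hA's, hmBs]
      have h1 := hAmass (l + 1)
      have h2 := hAmass l
      rw [← hd] at h1 h2
      push_cast at h1 h2 ⊢
      have h3 : (2 : ℝ) ^ l * 9 ^ (2 ^ l) ≤ 2 ^ (l + 1) * 9 ^ (2 ^ (l + 1)) :=
        mul_le_mul (pow_le_pow_right₀ one_le_two (Nat.le_succ l)) (pow_le_pow_right₀ (by norm_num)
          (Nat.pow_le_pow_right two_pos (Nat.le_succ l))) (by positivity) (by positivity)
      have h4 := mul_le_mul_of_nonneg_left h3 hdpos.le
      linarith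
  -- cube bounds of the increments
  have hl1 : ∀ x : ι → ℝ, (∀ i, x i ∈ Set.Icc (-1 : ℝ) 1) → |(∑ i, |x i|) - d / 2| ≤ d / 2 := by
    intro x hx
    have h0 : 0 ≤ ∑ i, |x i| := Finset.sum_nonneg fun i _ => abs_nonneg _
    have h1 : ∑ i, |x i| ≤ d := by
      calc ∑ i, |x i| ≤ ∑ _i : ι, (1 : ℝ) := Finset.sum_le_sum fun i _ => abs_le.2 ⟨(hx i).1, (hx i).2⟩
        _ = d := by rw [sum_const, card_univ, nsmul_eq_mul, mul_one]
    rw [abs_le]; constructor <;> linarith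
  have hBR : ∀ l, l < J + 1 → ∀ x : ι → ℝ, (∀ i, x i ∈ Set.Icc (-1 : ℝ) 1) → |MvPolynomial.eval x (B l)| ≤ R l := by
    intro l _ x hx
    rw [hB, map_sub]
    cases l with
    | zero =>
      rw [hA'0, hR0', MvPolynomial.eval_C]
      have h1 := hAerr 0 x hx
      rw [pow_zero, Nat.cast_one, div_one, ← hd] at h1
      calc |MvPolynomial.eval x (A 0) - d / 2|
          ≤ |MvPolynomial.eval x (A 0) - (∑ i, |x i|)| + |(∑ i, |x i|) - d / 2| := abs_sub_le _ _ _
        _ ≤ d * π + d / 2 := by rw [abs_sub_comm] at h1; exact add_le_add h1 (hl1 x hx)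
        _ = d * (1 / 2 + π) := by ring
    | succ l =>
      rw [hA's, hRs]
      have h1 := hAerr (l + 1) x hx
      have h2 := hAerr l x hx
      rw [← hd] at h1 h2
      calc |MvPolynomial.eval x (A (l + 1)) - MvPolynomial.eval x (A l)|
          ≤ |MvPolynomial.eval x (A (l + 1)) - (∑ i, |x i|)| + |(∑ i, |x i|) - MvPolynomial.eval x (A l)| := abs_sub_le _ _ _
        _ ≤ d * (π / (2 ^ (l + 1) : ℕ)) + d * (π / (2 ^ l : ℕ)) := by rw [abs_sub_comm] at h1; exact add_le_add h1 h2
        _ = 3 * d * π / 2 ^ (l + 1) := by push_cast; rw [pow_succ]; field_simp; ring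
  have hRmB : ∀ l, l < J + 1 → 0 < R l ∧ R l ≤ mB l := by
    intro l _
    refine ⟨hRpos l, ?_⟩
    cases l with
    | zero => rw [hR0', hmB0]; nlinarith [hdpos]
    | succ l =>
      rw [hRs, hmBs]
      have hX : (2 : ℝ) ≤ 2 ^ (l + 1) := by
        calc (2 : ℝ) = 2 ^ 1 := by norm_num
          _ ≤ 2 ^ (l + 1) := pow_le_pow_right₀ one_le_two (by omega)
      have hY : (9 : ℝ) ≤ 9 ^ (2 ^ (l + 1)) := by
        calc (9 : ℝ) = 9 ^ 1 := by norm_num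
          _ ≤ 9 ^ (2 ^ (l + 1)) := pow_le_pow_right₀ (by norm_num) Nat.one_le_two_pow
      rw [div_le_iff₀ (by positivity)]
      have hXYX : (2 : ℝ) * 9 * 2 ≤ 2 ^ (l + 1) * 9 ^ (2 ^ (l + 1)) * 2 ^ (l + 1) :=
        mul_le_mul (mul_le_mul hX hY (by norm_num) (by positivity)) hX (by norm_num) (by positivity)
      calc 3 * d * π ≤ 3 * d * 4 := by nlinarith [hdpos, hπ4]
        _ ≤ 2 * d * (2 * 9 * 2) := by nlinarith [hdpos]
        _ ≤ 2 * d * (2 ^ (l + 1) * 9 ^ (2 ^ (l + 1)) * 2 ^ (l + 1)) := mul_le_mul_of_nonneg_left hXYX (by positivity)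
        _ = 2 * d * (2 ^ (l + 1) * 9 ^ 2 ^ (l + 1)) * 2 ^ (l + 1) := by ring
  have hmpos : ∀ l, l < J + 1 → 0 < m l := fun l _ => by rw [hm]; positivity
  -- the error terms: `2ωR_lπ/m_l ≤ 60 ω d / 2^J` at every level
  have hηl : ∀ l, l < J + 1 → 2 * ω * R l * π / m l ≤ 60 * ω * d / 2 ^ J := by
    intro l hl
    have hlJ : l ≤ J := Nat.lt_succ_iff.1 hl
    have hmJ : ((m l : ℕ) : ℝ) * 2 ^ l = 2 ^ J := by
      rw [hm]; push_cast; rw [← pow_add, Nat.sub_add_cancel hlJ]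
    have hml0 : (0 : ℝ) < m l := by exact_mod_cast hmpos l hl
    rw [div_le_div_iff₀ hml0 (by positivity)]
    have hωd : 0 ≤ ω * d := mul_nonneg hω hdpos.le
    cases l with
    | zero =>
      rw [hR0']
      rw [pow_zero, mul_one] at hmJ
      have hc : 2 * (1 / 2 + π) * π ≤ 60 := by nlinarith [hπ4, hπ]
      calc 2 * ω * (d * (1 / 2 + π)) * π * 2 ^ J = (2 * (1 / 2 + π) * π) * (ω * d * 2 ^ J) := by ring
        _ ≤ 60 * (ω * d * 2 ^ J) := mul_le_mul_of_nonneg_right hc (by positivity)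
        _ = 60 * ω * d * ((m 0 : ℕ) : ℝ) := by rw [hmJ]; ring
    | succ l =>
      rw [hRs]
      -- `2ω(3dπ/2^{l+1})π·2^J ≤ 60ωd·m_{l+1}` with `m_{l+1}2^{l+1} = 2^J`
      have e : 2 * ω * (3 * d * π / 2 ^ (l + 1)) * π * 2 ^ J = 6 * π ^ 2 * (ω * d * ((m (l + 1) : ℕ) : ℝ)) := by
        rw [← hmJ]; field_simp; ring
      rw [e]
      have hπ2 : 6 * π ^ 2 ≤ 60 := by nlinarith [hπ4, Real.pi_lt_d2, Real.pi_pos]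
      calc 6 * π ^ 2 * (ω * d * ((m (l + 1) : ℕ) : ℝ)) ≤ 60 * (ω * d * ((m (l + 1) : ℕ) : ℝ)) :=
            mul_le_mul_of_nonneg_right hπ2 (by positivity)
        _ = 60 * ω * d * ((m (l + 1) : ℕ) : ℝ) := by ring
  have hηsum : ∑ l ∈ range (J + 1), 2 * ω * R l * π / m l ≤ 60 * ((J : ℝ) + 1) * ω * d / 2 ^ J := by
    calc ∑ l ∈ range (J + 1), 2 * ω * R l * π / m l ≤ ∑ _l ∈ range (J + 1), 60 * ω * d / 2 ^ J :=
          Finset.sum_le_sum fun l hl => hηl l (mem_range.1 hl)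
      _ = 60 * ((J : ℝ) + 1) * ω * d / 2 ^ J := by rw [sum_const, card_range, nsmul_eq_mul]; push_cast; ring
  have hηhalf : ∑ l ∈ range (J + 1), 2 * ω * R l * π / m l ≤ 1 / 2 := by
    refine hηsum.trans ?_
    have h2J : (0 : ℝ) < 2 ^ J := by positivity
    rw [div_le_iff₀ h2J]
    calc 60 * ((J : ℝ) + 1) * ω * d = (240 * ((J : ℝ) + 1) * ω * d) / 4 := by ring
      _ ≤ 2 ^ J / 4 := div_le_div_of_nonneg_right hsmall (by norm_num)
      _ ≤ 1 / 2 * 2 ^ J := by linarith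
  -- the ladder
  obtain ⟨Cr, Ci, hCr, hCi, happ⟩ := exists_pair_near_cexp_sum_mass (ι := ι) (ω * (d / 2)) hω B mB R m (J + 1)
    hmassB hRmB hBR hmpos hηhalf
  -- the phase telescopes to `ω·A_J(x)`
  have htel : ∀ x : ι → ℝ, ω * (d / 2) + ω * ∑ l ∈ range (J + 1), MvPolynomial.eval x (B l) = ω * MvPolynomial.eval x (A J) := by
    intro x
    have hsumB : ∑ l ∈ range (J + 1), MvPolynomial.eval x (B l) = MvPolynomial.eval x (A J) - d / 2 := by
      have hsub : ∀ l, MvPolynomial.eval x (B l) = MvPolynomial.eval x (A l) - MvPolynomial.eval x (A' l) := fun l => by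
        rw [hB, map_sub]
      simp only [hsub, Finset.sum_sub_distrib]
      rw [Finset.sum_range_succ (fun l => MvPolynomial.eval x (A l)), Finset.sum_range_succ' (fun l => MvPolynomial.eval x (A' l))]
      have hxA'0 : MvPolynomial.eval x (A' 0) = d / 2 := by rw [hA'0, MvPolynomial.eval_C]
      have hxA's : ∀ l, MvPolynomial.eval x (A' (l + 1)) = MvPolynomial.eval x (A l) := fun l => by rw [hA's]
      simp only [hxA'0, hxA's]
      ring
    rw [hsumB]; ring
  -- the sup bound `|cos(ωS) − Cr| ≤ 120(J+1)ωd/2^J + ωdπ/2^J` on the cube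
  have hsup : ∀ x : ι → ℝ, (∀ i, x i ∈ Set.Icc (-1 : ℝ) 1) →
      |Real.cos (ω * ∑ i, |x i|) - MvPolynomial.eval x Cr| ≤ 124 * ((J : ℝ) + 1) * ω * d / 2 ^ J := by
    intro x hx
    have h1 := happ x hx
    rw [htel x] at h1
    have htail : ‖exp (((ω * MvPolynomial.eval x (A J) : ℝ) : ℂ) * I) - exp (((ω * ∑ i, |x i| : ℝ) : ℂ) * I)‖ ≤ ω * d * π / 2 ^ J := by
      refine (norm_cexp_sub_cexp_le _ _).trans ?_
      rw [← mul_sub, abs_mul, abs_of_nonneg hω, abs_sub_comm, mul_assoc, mul_div_assoc]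
      refine mul_le_mul_of_nonneg_left ?_ hω
      have := hAerr J x hx
      rw [← hd] at this; push_cast at this
      calc |(∑ i, |x i|) - MvPolynomial.eval x (A J)| ≤ d * (π / 2 ^ J) := this
        _ = d * π / 2 ^ J := by ring
    have hz : ‖((MvPolynomial.eval x Cr : ℝ) : ℂ) + ((MvPolynomial.eval x Ci : ℝ) : ℂ) * I - exp (((ω * ∑ i, |x i| : ℝ) : ℂ) * I)‖ ≤
        2 * (60 * ((J : ℝ) + 1) * ω * d / 2 ^ J) + ω * d * π / 2 ^ J := by
      calc _ = ‖(((MvPolynomial.eval x Cr : ℝ) : ℂ) + ((MvPolynomial.eval x Ci : ℝ) : ℂ) * I -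
                exp (((ω * MvPolynomial.eval x (A J) : ℝ) : ℂ) * I)) +
              (exp (((ω * MvPolynomial.eval x (A J) : ℝ) : ℂ) * I) - exp (((ω * ∑ i, |x i| : ℝ) : ℂ) * I))‖ := by
            rw [sub_add_sub_cancel]
        _ ≤ _ := norm_add_le _ _
        _ ≤ _ := add_le_add (h1.trans (mul_le_mul_of_nonneg_left hηsum zero_le_two)) htail
    have hre : (((MvPolynomial.eval x Cr : ℝ) : ℂ) + ((MvPolynomial.eval x Ci : ℝ) : ℂ) * I -
            exp (((ω * ∑ i, |x i| : ℝ) : ℂ) * I)).re = MvPolynomial.eval x Cr - Real.cos (ω * ∑ i, |x i|) := by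
      simp only [Complex.sub_re, Complex.add_re, Complex.mul_re, Complex.ofReal_re, Complex.ofReal_im, Complex.I_re,
        Complex.I_im, Complex.exp_ofReal_mul_I_re]
      ring
    rw [abs_sub_comm, ← hre]
    refine ((Complex.abs_re_le_norm _).trans hz).trans ?_
    have h2J : (0 : ℝ) < 2 ^ J := by positivity
    rw [show 2 * (60 * ((J : ℝ) + 1) * ω * d / 2 ^ J) + ω * d * π / 2 ^ J = (120 * ((J : ℝ) + 1) * ω * d + ω * d * π) / 2 ^ J by ring,
      div_le_div_iff_of_pos_right h2J]
    have hJ0 : (0 : ℝ) ≤ J := Nat.cast_nonneg _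
    have hk : 0 ≤ ω * d * (4 * ((J : ℝ) + 1) - π) := mul_nonneg (mul_nonneg hω hdpos.le) (by linarith)
    linarith
  -- the mass bound `∏_l 2 m_l 9^{m_l} (mB_l/R_l)^{2m_l} ≤ 9^{6(J+1)2^J}`
  have hmass_tot : ∏ l ∈ range (J + 1), 2 * ((m l : ℝ) * 9 ^ m l * (mB l / R l) ^ (2 * m l)) ≤ (9 : ℝ) ^ (6 * (J + 1) * 2 ^ J) := by
    -- each factor `≤ 9^{6·2^J}`: `2m·9^m ≤ 9^{2m} ≤ 9^{2·2^J}` (`m ≤ 2^J`) and `(mB∕R)^{2m} ≤ (9^{2·2^l})^{2·2^{J−l}} = 9^{4·2^J}`.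
    have hfac : ∀ l ∈ range (J + 1), 2 * ((m l : ℝ) * 9 ^ m l * (mB l / R l) ^ (2 * m l)) ≤ (9 : ℝ) ^ (6 * 2 ^ J) := by
      intro l hl
      have hl' : l < J + 1 := mem_range.1 hl
      have hlJ : l ≤ J := Nat.lt_succ_iff.1 hl'
      have hml : m l = 2 ^ (J - l) := hm l
      have hmle : m l ≤ 2 ^ J := by rw [hml]; exact Nat.pow_le_pow_right two_pos (Nat.sub_le J l)
      -- `mB l / R l ≤ 9 ^ (2 * 2 ^ l)`
      have hρ : mB l / R l ≤ (9 : ℝ) ^ (2 * 2 ^ l) := by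
        rw [div_le_iff₀ (hRpos l)]
        cases l with
        | zero =>
          rw [hmB0, hR0']; norm_num; nlinarith [hdpos, Real.pi_gt_three]
        | succ l =>
          rw [hmBs, hRs]
          -- `2d·2^{l+1}9^{2^{l+1}} ≤ 9^{2·2^{l+1}}·3dπ/2^{l+1}` ⟸ `4^{l+1} ≤ 9^{2^{l+1}}` and `2 ≤ 3π`
          have h4 : ((2 : ℝ) ^ (l + 1)) ^ 2 ≤ 9 ^ (2 ^ (l + 1)) := by
            have hn : 2 * (l + 1) ≤ 2 ^ (l + 1) := by
              have := @Nat.lt_two_pow_self l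
              rw [pow_succ]; omega
            calc ((2 : ℝ) ^ (l + 1)) ^ 2 = 2 ^ (2 * (l + 1)) := by rw [← pow_mul, mul_comm]
              _ ≤ 2 ^ (2 ^ (l + 1)) := pow_le_pow_right₀ one_le_two hn
              _ ≤ 9 ^ (2 ^ (l + 1)) := pow_le_pow_left₀ zero_le_two (by norm_num) _
          rw [show (9 : ℝ) ^ (2 * 2 ^ (l + 1)) = 9 ^ (2 ^ (l + 1)) * 9 ^ (2 ^ (l + 1)) by rw [two_mul, pow_add]]
          rw [mul_div_assoc']
          rw [le_div_iff₀ (by positivity)]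
          set X : ℝ := 9 ^ (2 ^ (l + 1)) with hX
          set T : ℝ := 2 ^ (l + 1) with hT
          have hX0 : 0 < X := by positivity
          have hT0 : 0 < T := by positivity
          have h5 : T * T ≤ X := by rw [← sq]; exact h4
          calc 2 * d * (T * X) * T = 2 * d * X * (T * T) := by ring
            _ ≤ 2 * d * X * X := mul_le_mul_of_nonneg_left h5 (by positivity)
            _ ≤ X * X * (3 * d * π) := by nlinarith [Real.pi_gt_three, mul_pos (mul_pos hdpos hX0) hX0]
      have hρ0 : 0 ≤ mB l / R l := div_nonneg ((Finset.sum_nonneg fun s _ => abs_nonneg _).trans (hmassB l hl')) (hRpos l).le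
      have hpow : (mB l / R l) ^ (2 * m l) ≤ (9 : ℝ) ^ (4 * 2 ^ J) := by
        calc (mB l / R l) ^ (2 * m l) ≤ ((9 : ℝ) ^ (2 * 2 ^ l)) ^ (2 * m l) := pow_le_pow_left₀ hρ0 hρ _
          _ = 9 ^ (2 * 2 ^ l * (2 * m l)) := by rw [← pow_mul]
          _ = 9 ^ (4 * 2 ^ J) := by
              rw [hml, show 2 * 2 ^ l * (2 * 2 ^ (J - l)) = 4 * (2 ^ l * 2 ^ (J - l)) by ring, ← pow_add,
                Nat.add_sub_cancel' hlJ]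
      have h2m : 2 * ((m l : ℝ) * 9 ^ m l) ≤ (9 : ℝ) ^ (2 * 2 ^ J) := by
        have hm1 : (1 : ℝ) ≤ m l := by exact_mod_cast hmpos l hl'
        have hmr : (m l : ℝ) ≤ 2 ^ J := by exact_mod_cast hmle
        -- `2m·9^m ≤ 9^m·9^m ≤ ...`; cruder: `2m ≤ 4^m ≤ 9^{...}`; use `2 m ≤ 9^{m}` and `9^m·9^m = 9^{2m}`... keep it simple:
        have h2m' : 2 * (m l : ℝ) ≤ 9 ^ m l := by
          have : ∀ n : ℕ, 2 * (n : ℝ) ≤ 9 ^ n := by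
            intro n; induction n with
            | zero => norm_num
            | succ k ih => push_cast; rw [pow_succ]; nlinarith [one_le_pow₀ (by norm_num : (1:ℝ) ≤ 9) (n := k)]
          exact this _
        calc 2 * ((m l : ℝ) * 9 ^ m l) = (2 * m l) * 9 ^ m l := by ring
          _ ≤ 9 ^ m l * 9 ^ m l := mul_le_mul_of_nonneg_right h2m' (by positivity)
          _ = 9 ^ (2 * m l) := by rw [← pow_add, two_mul]
          _ ≤ 9 ^ (2 * 2 ^ J) := by
              refine pow_le_pow_right₀ (by norm_num) ?_
              rw [hml]
              exact Nat.mul_le_mul_left 2 (Nat.pow_le_pow_right two_pos (Nat.sub_le J l))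
      calc 2 * ((m l : ℝ) * 9 ^ m l * (mB l / R l) ^ (2 * m l)) = 2 * ((m l : ℝ) * 9 ^ m l) * (mB l / R l) ^ (2 * m l) := by ring
        _ ≤ 9 ^ (2 * 2 ^ J) * 9 ^ (4 * 2 ^ J) := mul_le_mul h2m hpow (by positivity) (by positivity)
        _ = 9 ^ (6 * 2 ^ J) := by rw [← pow_add]; ring_nf
    have hpos : ∀ l ∈ range (J + 1), 0 ≤ 2 * ((m l : ℝ) * 9 ^ m l * (mB l / R l) ^ (2 * m l)) := by
      intro l hl
      have hρ0 : 0 ≤ mB l / R l :=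
        div_nonneg ((Finset.sum_nonneg fun s _ => abs_nonneg _).trans (hmassB l (mem_range.1 hl))) (hRpos l).le
      positivity
    calc ∏ l ∈ range (J + 1), 2 * ((m l : ℝ) * 9 ^ m l * (mB l / R l) ^ (2 * m l))
        ≤ ∏ _l ∈ range (J + 1), (9 : ℝ) ^ (6 * 2 ^ J) := Finset.prod_le_prod hpos hfac
      _ = 9 ^ (6 * 2 ^ J * (J + 1)) := by rw [prod_const, card_range, ← pow_mul]
      _ = 9 ^ (6 * (J + 1) * 2 ^ J) := by ring_nf
  -- assemble: `|∫cos − ∫cos| ≤ 2·sup + mass·r`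
  have hc : Continuous fun x : ι → ℝ => Real.cos (ω * ∑ i, |x i|) :=
    Real.continuous_cos.comp (continuous_const.mul (continuous_finsetSum _ fun i _ => (continuous_apply i).abs))
  have hCrc : Continuous fun x : ι → ℝ => MvPolynomial.eval x Cr := MvPolynomial.continuous_eval Cr
  have hcC : Continuous fun x : ι → ℝ => Real.cos (ω * ∑ i, |x i|) - MvPolynomial.eval x Cr := hc.sub hCrc
  have hsplit : ∀ (μ : Measure (ι → ℝ)) [IsProbabilityMeasure μ], μ (Set.pi Set.univ (fun _ : ι => Set.Icc (-1 : ℝ) 1))ᶜ = 0 →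
      ∫ x, Real.cos (ω * ∑ i, |x i|) ∂μ = ∫ x, (Real.cos (ω * ∑ i, |x i|) - MvPolynomial.eval x Cr) ∂μ + ∫ x, MvPolynomial.eval x Cr ∂μ := by
    intro μ _ hμ
    rw [← integral_add (integrable_of_continuous_of_cube hμ hcC) (integrable_of_continuous_of_cube hμ hCrc)]
    refine integral_congr_ae (Filter.Eventually.of_forall fun x => ?_)
    simp only [sub_add_cancel]
  rw [hsplit P hP, hsplit Q hQ, add_sub_add_comm]
  have h1 := abs_integral_le_of_cube hP (f := fun x => Real.cos (ω * ∑ i, |x i|) - MvPolynomial.eval x Cr) hsup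
  have h2 := abs_integral_le_of_cube hQ (f := fun x => Real.cos (ω * ∑ i, |x i|) - MvPolynomial.eval x Cr) hsup
  have h3 := abs_integral_eval_sub_le_mass hP hQ hmom Cr
  have hmassCr : (∑ s ∈ Cr.support, |Cr.coeff s|) ≤ (9 : ℝ) ^ (6 * (J + 1) * 2 ^ J) := hCr.trans hmass_tot
  calc |(∫ x, (Real.cos (ω * ∑ i, |x i|) - MvPolynomial.eval x Cr) ∂P - ∫ x, (Real.cos (ω * ∑ i, |x i|) - MvPolynomial.eval x Cr) ∂Q) +
        (∫ x, MvPolynomial.eval x Cr ∂P - ∫ x, MvPolynomial.eval x Cr ∂Q)|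
      ≤ |∫ x, (Real.cos (ω * ∑ i, |x i|) - MvPolynomial.eval x Cr) ∂P - ∫ x, (Real.cos (ω * ∑ i, |x i|) - MvPolynomial.eval x Cr) ∂Q| +
        |∫ x, MvPolynomial.eval x Cr ∂P - ∫ x, MvPolynomial.eval x Cr ∂Q| := abs_add_le _ _
    _ ≤ (124 * ((J : ℝ) + 1) * ω * d / 2 ^ J + 124 * ((J : ℝ) + 1) * ω * d / 2 ^ J) + (∑ s ∈ Cr.support, |Cr.coeff s|) * r :=
        add_le_add ((abs_sub _ _).trans (add_le_add h1 h2)) h3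
    _ ≤ 248 * ((J : ℝ) + 1) * ω * d / 2 ^ J + 9 ^ (6 * (J + 1) * 2 ^ J) * r := by
        have := mul_le_mul_of_nonneg_right hmassCr hr
        have e : 124 * ((J : ℝ) + 1) * ω * d / 2 ^ J + 124 * ((J : ℝ) + 1) * ω * d / 2 ^ J = 248 * ((J : ℝ) + 1) * ω * d / 2 ^ J := by
          ring
        rw [e]
        exact add_le_add le_rfl this

/-- ★★ **THE SINGLE MODE IN THE MOMENT CURRENCY, `L`-FORM.**  In the setting of `abs_integral_cos_l1Norm_sub_le_multiscale`, if moreover `0 < r ≤ 1`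
and `12(J+1)2^J·log 9 ≤ L := log r⁻¹`, then `|∫cos(ωS)dP − ∫cos(ωS)dQ| ≤ 248(J+1)·ωd∕2^J + e^{−L∕2}`.  READING: with `2^J ≍ L∕(22(J+2))` (the
largest admissible), `≲ 5500·ωd·log²₂L∕L + e^{−L∕2}` — the single mode of the ℓ¹-norm of `d` strings in the uniform mixed-moment currency at the ridge
rate up to `log²`, non-trivial for `ωd ≲ L∕log²L` (module 116: `(cosh(ωd) − 1)·96∕(1+L)`, non-trivial for `ωd ≲ log L` only). [folklore] -/
theorem abs_integral_cos_l1Norm_sub_le_multiscale_of_small [Nonempty ι] {P Q : Measure (ι → ℝ)} [IsProbabilityMeasure P]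
    [IsProbabilityMeasure Q]
    (hP : P (Set.pi Set.univ (fun _ : ι => Set.Icc (-1 : ℝ) 1))ᶜ = 0) (hQ : Q (Set.pi Set.univ (fun _ : ι => Set.Icc (-1 : ℝ) 1))ᶜ = 0)
    {r : ℝ} (hr0 : 0 < r) (hmom : ∀ j : ι → ℕ, |∫ x, ∏ i, x i ^ j i ∂P - ∫ x, ∏ i, x i ^ j i ∂Q| ≤ r)
    {ω : ℝ} (hω : 0 ≤ ω) {J : ℕ} (hsmall : 240 * ((J : ℝ) + 1) * ω * Fintype.card ι ≤ 2 ^ J)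
    (hL : 12 * ((J : ℝ) + 1) * 2 ^ J * Real.log 9 ≤ Real.log r⁻¹) :
    |∫ x, Real.cos (ω * ∑ i, |x i|) ∂P - ∫ x, Real.cos (ω * ∑ i, |x i|) ∂Q| ≤
      248 * ((J : ℝ) + 1) * ω * Fintype.card ι / 2 ^ J + Real.exp (-(Real.log r⁻¹ / 2)) := by
  have h := abs_integral_cos_l1Norm_sub_le_multiscale hP hQ hr0.le hmom hω hsmall
  refine h.trans (add_le_add le_rfl ?_)
  -- `9^{6(J+1)2^J}·r = exp(6(J+1)2^J log 9 − L) ≤ exp(−L/2)`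
  have hr : r = Real.exp (-Real.log r⁻¹) := by
    rw [Real.exp_neg, Real.exp_log (inv_pos.2 hr0), inv_inv]
  have h9 : (9 : ℝ) ^ (6 * (J + 1) * 2 ^ J) = Real.exp ((6 * ((J : ℝ) + 1) * 2 ^ J) * Real.log 9) := by
    rw [← Real.rpow_natCast, Real.rpow_def_of_pos (by norm_num)]
    congr 1; push_cast; ring
  rw [h9]
  conv_lhs => rw [hr]
  rw [← Real.exp_add]
  refine Real.exp_le_exp.2 ?_
  linarith

end Summit.QuantumFields.YangMills.Theorems.BalabanUVNodesN19SingleModeMomentCurrency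

end
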